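import Mathlib
import Literature.Combinatorics.Optimization.MaxThreeSatLpLowerBound

/-!
# MAX-3XOR: no LP relaxation of size `2^{c n^{1/H}}` beats `1/2` (Kothari–Meka–Raghavendra 2017/22,
Corollary 1.5, MAX-3XOR clause), DERIVED from Theorem 1.10 and the Grigoriev/Schoenebeck
linear-round Sherali–Adams gap

Companion of `MaxThreeSatLpLowerBound.lean` (MAX-3SAT) and `MaxCutLpLowerBound.lean` (MAX-CUT).
One new named fact is vendored — the linear-round Sherali–Adams lower bound for MAX-3XOR, in the
form in which Kothari–Meka–Raghavendra restate and use it: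

> **KMR Thm 7.5 (p. 21) ([Gri01, Schoenebeck08, BGMT12]).** "For every `k`-ary pairwise independent
> predicate `P` and `ε > 0`, there exists a constant `c = c(k, ε)` such that the `cn`-round
> Sherali-Adams relaxation for MAX-CSP problem on predicate `P` achieves [sic: does not achieve] a
> `(|P^{-1}(1)|/2^k + ε, 1 − ε)`-approximation. As a corollary, for some constants `c_1(ε), c_2(ε)`,
> … the `c_2(ε)`-round Sherali-Adams relaxation for MAX-3XOR does not achieve a
> `(1/2+ε, 1−ε)`-approximation."  (p. 21, before: "Grigoriev [Gri01] showed a lower bound for the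
> Sum-of-Squares SDP hierarchy (that is a strengthening of the Sherali-Adams LP hierarchy and thus
> the lower bounds carry over) for 3XOR; Schoenebeck [Schoenebeck08] rediscovered this result".)

— typed as `Schoenebeck2008_maxThreeXorSA` in the tree's Sherali–Adams currency (`SAAchieves`;
the printed pair lists the soundness `1/2 + ε` first): for every `ε > 0` there are `c_ε > 0` and
`n₀` with: for all `n ≥ n₀` some MAX-3XOR instance (CSP(`xor₃`) with literals, `literalClosure
xorThree`) on `n` variables with `opt ≤ 1/2 + ε` has degree-`⌊c_ε n⌋` Sherali–Adams value `> 1 − ε`.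
RECORDED RENDERING DECISIONS: (i) "`c_2(ε)`-round" in the corollary sentence is read, as in the
theorem's first sentence ("`cn`-round"), as `⌊c_ε n⌋` rounds (linear); (ii) "for every `n`" is typed
"for every `n ≥ n₀(ε)`" (random/explicit constructions are asymptotic; for `n ≤ 2` there are no
instances); (iii) the proving sources are Grigoriev (Theoret. Comput. Sci. 259 (2001)) and
G. Schoenebeck, FOCS 2008 (doi:10.1109/FOCS.2008.74), neither restated further here; the fact is a
third-party input NOT proved in the tree (D-0026: the single new fact of this file, consumed below).

Main result: `KothariMekaRaghavendra2017_cor15_threeXor_of_thm110 :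
KothariMekaRaghavendra2017_thm110 → Schoenebeck2008_maxThreeXorSA →
KothariMekaRaghavendra2017_cor15_threeXor`, exactly as for MAX-3SAT (p. 21 "follow similarly"):
`f(m) = ⌊c_ε m⌋`, `(c,s) = (1 − ε/8, 1/2 + ε/8)`, padding `n ↦ ⌊n^{1/H}⌋^H`, `c_2 = h c_ε/4`.

Sources: [KothariMekaRaghavendra2017] held text `paper:arxiv-1610.02704` (Thm 1.4 p. 4, Cor 1.5
p. 4, Thm 7.5 and the proof of Cor 1.5 p. 21).
-/

noncomputable section

open Finset Filter

namespace Literature.Combinatorics.Optimization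

/-! ### The linear-round Sherali–Adams gap for MAX-3XOR (named fact) -/

/-- **Grigoriev 2001 / Schoenebeck 2008 (as restated in Kothari–Meka–Raghavendra 2017, Thm 7.5 =
Thm 1.4, MAX-3XOR clause): linear-round Sherali–Adams does not beat `1/2` on MAX-3XOR.** For every
`ε > 0` there are `c_ε > 0` and `n₀` such that for every `n ≥ n₀` the degree-`⌊c_ε n⌋` Sherali–Adams
relaxation fails to achieve a `(1 − ε, 1/2 + ε)`-approximation for MAX-3XOR on `n` variables.  See
the module docstring for the reading of "`c_2(ε)`-round" and the threshold `n₀`.  NOT proved here.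
[cite: KothariMekaRaghavendra2017, Thm 7.5 (p. 21) and Thm 1.4 (p. 4)] -/
def Schoenebeck2008_maxThreeXorSA : Prop :=
  ∀ ε : ℝ, 0 < ε → ∃ cε : ℝ, 0 < cε ∧ ∃ n₀ : ℕ, ∀ n : ℕ, n₀ ≤ n →
    ¬ SAAchieves (n := n) (literalClosure xorThree) ⌊cε * n⌋₊ (1 - ε) (1 / 2 + ε)

/-! ### Corollary 1.5 (MAX-3XOR) from Theorem 1.10 and the 3XOR gap -/

/-- **Kothari–Meka–Raghavendra 2017/22, Corollary 1.5 (MAX-3XOR) DERIVED from Theorem 1.10 and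
`Schoenebeck2008_maxThreeXorSA`:** for the universal `H` of Thm 1.2, for every `ε > 0` there are
`c₂ > 0` and `n₀` such that for all `n ≥ n₀` no LP relaxation of MAX-3XOR on `n` variables of size
`R < 2^{c₂ n^{1/H}}` has integrality gap less than `2 − ε`.  Proof as for MAX-3SAT (p. 21): WLOG
`ε ≤ 1/100`; `s = 1/2 + ε/8`, `c = 1 − ε/8`, `f(m) = ⌊c_ε m⌋`; Thm 1.2 (from Thm 1.10) on `m^H`
variables; restriction of a relaxation on `n ≥ m^H` variables, `m = ⌊n^{1/H}⌋`; `(2 − ε)s ≤ c − 1/m`;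
`2^{c₂ n^{1/H}} ≤ m^{h f(m)}` for `c₂ = h c_ε/4`.
[cite: KothariMekaRaghavendra2017, Cor. 1.5 (p. 4) and its proof (§7, p. 21)] -/
theorem KothariMekaRaghavendra2017_cor15_threeXor_of_thm110
    (h110 : KothariMekaRaghavendra2017_thm110) (hX : Schoenebeck2008_maxThreeXorSA) :
    KothariMekaRaghavendra2017_cor15_threeXor := by
  obtain ⟨h, H, n₀, hh, hhH, T12⟩ := KothariMekaRaghavendra2017_thm12_of_thm110 h110
  have hH0 : H ≠ 0 := by
    rintro rfl
    simp at hhH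
    linarith
  have hH1 : (1 : ℝ) ≤ H := by exact_mod_cast Nat.one_le_iff_ne_zero.2 hH0
  have hHpos : (0 : ℝ) < H := by linarith
  refine ⟨H, hH1, ?_⟩
  -- WLOG `ε ≤ 1/100`
  suffices main : ∀ ε : ℝ, 0 < ε → ε ≤ 1 / 100 → ∃ c₁ : ℝ, 0 < c₁ ∧ ∃ N₀ : ℕ, ∀ N : ℕ, N₀ ≤ N →
      ∀ R : ℕ, (R : ℝ) < (2 : ℝ) ^ (c₁ * (N : ℝ) ^ (1 / (H : ℝ))) →
        ∀ L : LPRelaxation 3 N (literalClosure xorThree) R, ¬ L.GapLT (2 - ε) by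
    intro ε hε
    obtain ⟨c₁, hc₁, N₀, hN₀⟩ := main (min ε (1 / 100)) (lt_min hε (by norm_num)) (min_le_right _ _)
    exact ⟨c₁, hc₁, N₀, fun N hN R hR L hL =>
      hN₀ N hN R hR L (hL.mono (by linarith [min_le_left ε (1 / 100)]))⟩
  intro ε hε hε1
  -- the Sherali–Adams lower bound (Thm 7.5, MAX-3XOR clause) at `ε/8`
  obtain ⟨cε, hcε, n₁, H65⟩ := hX (ε / 8) (by positivity)
  -- parameters
  set s : ℝ := 1 / 2 + ε / 8 with hsdef
  set c : ℝ := 1 - ε / 8 with hcdef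
  have hs0 : 0 ≤ s := by rw [hsdef]; positivity
  have hc1 : c < 1 := by rw [hcdef]; linarith
  have hcs : 1 / 10 < c - s := by rw [hcdef, hsdef]; linarith
  set f : ℕ → ℕ := fun m => ⌊cε * m⌋₊ with hfdef
  set c₁ : ℝ := h * cε / 4 with hc₁def
  have hc₁ : 0 < c₁ := by rw [hc₁def]; positivity
  -- thresholds
  set nthr : ℕ := n₀ + n₁ + 10 + ⌈98 / cε⌉₊ + ⌈8 / ε⌉₊ with hnthr
  refine ⟨c₁, hc₁, (nthr + 1) ^ H, fun N hN R hR L hL => ?_⟩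
  -- `y = N^{1/H}`, `m = ⌊y⌋`
  set y : ℝ := (N : ℝ) ^ (1 / (H : ℝ)) with hydef
  have hy0 : 0 ≤ y := Real.rpow_nonneg (Nat.cast_nonneg N) _
  have hyH : y ^ H = N := by
    rw [hydef, one_div]; exact Real.rpow_inv_natCast_pow (Nat.cast_nonneg N) hH0
  have hythr : (nthr : ℝ) + 1 ≤ y := by
    have h1 : (((nthr + 1) ^ H : ℕ) : ℝ) ≤ N := by exact_mod_cast hN
    have h2 : ((((nthr + 1) ^ H : ℕ) : ℝ)) ^ (1 / (H : ℝ)) ≤ y :=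
      Real.rpow_le_rpow (Nat.cast_nonneg _) h1 (by positivity)
    have h3 : ((((nthr + 1) ^ H : ℕ) : ℝ)) ^ (1 / (H : ℝ)) = nthr + 1 := by
      push_cast
      rw [one_div]
      exact Real.pow_rpow_inv_natCast (by positivity) hH0
    linarith
  set m : ℕ := ⌊y⌋₊ with hmdef
  have hmy : (m : ℝ) ≤ y := Nat.floor_le hy0
  have hmy' : y - 1 ≤ (m : ℝ) := (Nat.sub_one_lt_floor y).le
  have hmthr : nthr ≤ m := by
    have : (nthr : ℝ) ≤ m := by linarith
    exact_mod_cast this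
  have hnthr10 : (10 : ℝ) ≤ nthr := by exact_mod_cast (by omega : 10 ≤ nthr)
  have hmy2 : y / 2 ≤ (m : ℝ) := by linarith
  have hmH : m ^ H ≤ N := by
    have h1 : ((m : ℝ)) ^ H ≤ y ^ H := pow_le_pow_left₀ (Nat.cast_nonneg m) hmy H
    rw [hyH] at h1
    exact_mod_cast h1
  -- consequences of `m ≥ nthr`
  have hmn₀ : n₀ ≤ m := by omega
  have hmn₁ : n₁ ≤ m := by omega
  have hm10 : 10 ≤ m := by omega
  have hmR : (10 : ℝ) ≤ m := by exact_mod_cast hm10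
  have hm0 : (0 : ℝ) < m := by linarith
  have hm98 : 98 / cε ≤ (m : ℝ) := by
    have h1 : ⌈98 / cε⌉₊ ≤ m := by omega
    exact (Nat.le_ceil _).trans (by exact_mod_cast h1)
  have hm3 : 8 / ε ≤ (m : ℝ) := by
    have h1 : ⌈8 / ε⌉₊ ≤ m := by omega
    exact (Nat.le_ceil _).trans (by exact_mod_cast h1)
  have hcεm : 98 ≤ cε * m := by
    rw [div_le_iff₀ hcε] at hm98; linarith
  have h1m : 1 / (m : ℝ) ≤ 1 / 10 := one_div_le_one_div_of_le (by norm_num) hmR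
  have h1mε : 1 / (m : ℝ) ≤ ε / 8 := by
    have h1 : 1 / (m : ℝ) ≤ 1 / (8 / ε) := one_div_le_one_div_of_le (by positivity) hm3
    rwa [one_div_div] at h1
  -- `f(m) = ⌊cε m⌋`: `48 ≤ f(m)`, `f(m) ≥ (cε/2) m`
  have hfm_ge : cε * m - 1 ≤ ((f m : ℕ) : ℝ) := (Nat.sub_one_lt_floor _).le
  have h48 : 16 * 3 ≤ f m := by
    show 48 ≤ f m
    apply Nat.le_floor
    push_cast
    linarith
  have hfm4 : cε / 2 * m ≤ ((f m : ℕ) : ℝ) := by linarith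
  -- Sherali–Adams fails `(c,s)` at degree `f(m)` on `m` variables
  have hSA : ¬ SAAchieves (n := m) (literalClosure xorThree) (f m) c s := H65 m hmn₁
  -- the restricted relaxation achieves `(c − 1/m, s)` on `m^H` variables
  have hgap : 1 / (m : ℝ) < c - s := by linarith
  have hρ : (2 - ε) * s ≤ c - 1 / m := by
    have h1 : (2 - ε) * s = 1 - ε / 4 - ε ^ 2 / 8 := by rw [hsdef]; ring
    rw [h1, hcdef]
    nlinarith [sq_nonneg ε]
  have hc0 : 0 ≤ c - 1 / m := by rw [hcdef]; linarith
  have hAch : (L.restrict (Fin.castLEEmb hmH)).Achieves (c - 1 / m) s :=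
    (hL.achieves hs0 hρ hc0).restrict _
  -- the size bound: `R < 2^{c₁ N^{1/H}} ≤ m^{h f(m)}`
  have hkey : (2 : ℝ) ^ (c₁ * y) ≤ (m : ℝ) ^ (h * (f m : ℕ)) := by
    rw [Real.rpow_def_of_pos two_pos, Real.rpow_def_of_pos hm0, Real.exp_le_exp]
    have hlog2 : 0 < Real.log 2 := Real.log_pos one_lt_two
    have hlog2m : Real.log 2 ≤ Real.log m := Real.log_le_log two_pos (by linarith)
    have hfy : cε / 2 * (y / 2) ≤ ((f m : ℕ) : ℝ) := by nlinarith
    calc Real.log 2 * (c₁ * y) = Real.log 2 * h * (cε / 2 * (y / 2)) := by rw [hc₁def]; ring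
      _ ≤ Real.log 2 * h * ((f m : ℕ) : ℝ) :=
          mul_le_mul_of_nonneg_left hfy (by positivity)
      _ ≤ Real.log m * h * ((f m : ℕ) : ℝ) := by
          apply mul_le_mul_of_nonneg_right (mul_le_mul_of_nonneg_right hlog2m hh.le)
          positivity
      _ = Real.log m * (h * ((f m : ℕ) : ℝ)) := by ring
  have hRle : (R : ℝ) ≤ (m : ℝ) ^ (h * (f m : ℕ)) := (hR.trans_le hkey).le
  exact T12 3 (literalClosure xorThree) c s hc1.le f m hmn₀ hgap h48 hSA R hRle _ hAch

end Literature.Combinatorics.Optimization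

end
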